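import Summits.ResolutionOfSingularities.ResolutionOfSingularities.Theorems.EquisingularLiftEquisingularLiftNatHypLocPrincipalForm
import Summits.ResolutionOfSingularities.ResolutionOfSingularities.Theorems.EquisingularLiftEquisingularLiftNatRegularCase
import HarnessLib

/-!
# EL♮ / EL♮(3) — RUNG LC in the crux's currency, with the isomorphism case folded in

leafhand-res-equisingularlift-5 g0 (prover, 2026-08-31; cell `pub/decomp-res`; item (r1) of leafhand-4's repair census, second file).  Crux
`EquisingularLiftNatThree` (`stmt-…-20148`; uniform in `n`, so also `EquisingularLiftNat` `stmt-…-20038`), line W4.5(b), RUNG LC.  DEF-FREE; no `sorry`;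
standard axioms; ZERO named hypotheses; `--supports stmt-…-20148 --as helper`, counted 0.

The dictionary ✓ `LargeChar.isIso_or_exists_prime_form_range_eq_of_hyp` (…NatHypLocPrincipalForm) splits the crux hypothesis «`ι : H ↪ ℙⁿ_k` closed,
`H` integral, `ker ι` locally principal» into «`ι` an isomorphism» OR «`range ι = V₊(F)`, `F` a prime form».  This file records:

* `elnatO_of_isRegular` — `ELNatConclusionO` (the flat-centre text of record) for a REGULAR `H`: the empty tower over `𝕎(k)`, the proof of
  ✓ `elnat_of_isRegular` (…NatRegularCase) verbatim;
* `elnat_of_isIso` — the ISOMORPHISM case holds outright, for every `p`: `H ≅ ℙⁿ_k` is regular (✓ `isRegular_projectiveSpace`,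
  `Scheme.IsRegular.of_iso`);
* `elnat_of_hyp_of_forall_degree` — **the crux conclusion from a degree-wise supplier**: if for the given `p, k, n` the cut
  «`H` integral ∧ `F ≠ 0` ∧ `range ι = V₊(F)`» of ✓ `elnat_largeChar` is served for EVERY degree `d` (hypothesis `hdeg`), then `ELNatConclusionO k n H ι`
  for EVERY `(H, ι)` satisfying the crux hypotheses — i.e. EL♮(n) at `p` reduces EXACTLY to its hypersurface instances `range ι = V₊(F)`, `F` prime;
* ★ `elnat_largeChar_of_hyp'` — RUNG LC in crux currency with the isomorphism case included: for all `n, D` there is `M(n, D)` such that for `p > M`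
  every `(H, ι)` satisfying the crux hypotheses with «`ι` an isomorphism ∨ `range ι` on some hypersurface of degree `≤ D`» satisfies `ELNatConclusionO`.

HONEST READING: rungs and reductions only — `M` is ineffective and depends on the degree bound; EL♮(3) / EL♮ / `EquisingularLift` quantify over ALL `H`
at a fixed `p` and are NOT proved; no registered stub is closed; resolution of singularities in positive characteristic is NOT proved; nothing of
[Hironaka2017] (a candidate under adjudication) is asserted or used.  AI-written; AI review is weaker than expert review.
[cite: Hartshorne1977, II Prop. 6.4] [cite: Grothendieck1966, EGA IV₃ §8–§9] (method; index only)
-/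

set_option linter.dupNamespace false -- mandated namespace `Summit.<Summit>.<Problem>` of this single-conjunct summit

noncomputable section

open CategoryTheory CategoryTheory.Limits AlgebraicGeometry TopologicalSpace Topology
open MvPolynomial HomogeneousIdeal
open Literature.AlgebraicGeometry.Resolution Literature.AlgebraicGeometry.Motives
open Summit.ResolutionOfSingularities.ResolutionOfSingularities.Cruxes.EquisingularLift.StrataSplit

namespace Summit.ResolutionOfSingularities.ResolutionOfSingularities.Cruxes.EquisingularLiftNat.Sections

namespace LargeChar

/-- **`ELNatConclusionO` for a REGULAR `H`** (the flat-centre text of record; the proof of ✓ `elnat_of_isRegular` verbatim, whose empty tower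
`(ℙⁿ_𝕎(k), 𝟙, Y)` satisfies every step-closure clause): `O := 𝕎(k)`; for every graded `φ = MvPolynomial.map π` and `Y = range (ι ≫ Proj.map φ)`,
`V(closure Y)_red ≅ H` is regular. [OURS · DEF-FREE] [folklore] -/
theorem elnatO_of_isRegular (p : ℕ) (hp : p.Prime) (k : Type) [Field k] [CharP k p] [IsAlgClosed k] (n : ℕ) (H : Scheme.{0})
    (ι : H ⟶ (Literature.AlgebraicGeometry.Motives.projectiveSpace n k).left) (hι : IsClosedImmersion ι) (hH : IsIntegral H)
    (hHreg : Scheme.IsRegular H) : ELNatConclusionO k n H ι := by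
  obtain ⟨O, i1, i2, i3, i4, _i5, _i6, π, hπ⟩ := stub_wittRing p hp k
  refine ⟨O, i1, i2, i3, i4, π, hπ, ?_⟩
  letI := MvPolynomial.gradedAlgebra (σ := Fin (n + 1)) (R := O)
  letI := MvPolynomial.gradedAlgebra (σ := Fin (n + 1)) (R := k)
  intro φ hφ' hφ Y hY
  -- the comparison `g = Proj.map φ : ℙⁿ_k ⟶ ℙⁿ_O` is a closed immersion onto the special fibre
  have hP := ProjectiveAmbientFibre.isPullback_projMap π φ hφ hπ hφ'
  set g : Proj (homogeneousSubmodule (Fin (n + 1)) k) ⟶ Proj (homogeneousSubmodule (Fin (n + 1)) O) :=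
    Proj.map φ hφ' with hg
  haveI : IsClosedImmersion (Spec.map (CommRingCat.ofHom π)) := IsClosedImmersion.spec_of_surjective _ hπ
  haveI : IsClosedImmersion g := MorphismProperty.IsStableUnderBaseChange.of_isPullback hP.flip inferInstance
  haveI := hH
  let ι' : H ⟶ Proj (homogeneousSubmodule (Fin (n + 1)) k) := ι
  haveI : IsClosedImmersion ι' := hι
  let f : H ⟶ Proj (homogeneousSubmodule (Fin (n + 1)) O) := ι' ≫ g
  have hYf : Y = Set.range f := hY
  -- the EMPTY chain at the fixed model
  refine ⟨Proj (homogeneousSubmodule (Fin (n + 1)) O), 𝟙 _, Y, fun Q h0 _ => h0, ?_⟩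
  · -- `V(Y)_red ≅ H` is regular
    have hcl : closure Y = Set.range f := by rw [hYf]; exact f.isClosedEmbedding.isClosed_range.closure_eq
    have hYc : (⟨closure Y, isClosed_closure⟩ : Closeds (Proj (homogeneousSubmodule (Fin (n + 1)) O))) =
        ⟨Set.range f, f.isClosedEmbedding.isClosed_range⟩ := Closeds.ext hcl
    rw [hYc]
    have hYker : Scheme.IdealSheafData.vanishingIdeal
        (⟨Set.range f, f.isClosedEmbedding.isClosed_range⟩ : Closeds (Proj (homogeneousSubmodule (Fin (n + 1)) O))) =
          f.ker := by
      rw [← Scheme.IdealSheafData.map_bot, ← Scheme.nilradical_eq_bot, ← Scheme.IdealSheafData.vanishingIdeal_top,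
        Scheme.IdealSheafData.map_vanishingIdeal]
      congr 1
      ext1
      change Set.range f = closure (f '' Set.univ)
      rw [Set.image_univ, f.isClosedEmbedding.isClosed_range.closure_eq]
    have hker : (Scheme.IdealSheafData.vanishingIdeal
        (⟨Set.range f, f.isClosedEmbedding.isClosed_range⟩ :
          Closeds (Proj (homogeneousSubmodule (Fin (n + 1)) O)))).subschemeι.ker = f.ker := by
      rw [Scheme.IdealSheafData.ker_subschemeι, hYker]
    haveI := IsClosedImmersion.isIso_lift _ f hker
    exact Scheme.IsRegular.of_iso (IsClosedImmersion.lift _ f hker.le) hHreg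

/-- **The isomorphism case of the dictionary holds outright** (every `p`): if `ι : H ⟶ ℙⁿ_k` is an isomorphism then `H` is regular
(✓ `isRegular_projectiveSpace`) and `elnatO_of_isRegular` gives `ELNatConclusionO k n H ι`. [OURS · DEF-FREE] [folklore] -/
theorem elnat_of_isIso (p : ℕ) (hp : p.Prime) (k : Type) [Field k] [CharP k p] [IsAlgClosed k] (n : ℕ) (H : Scheme.{0})
    (ι : H ⟶ (Literature.AlgebraicGeometry.Motives.projectiveSpace n k).left) (hι : IsClosedImmersion ι) (hH : IsIntegral H)
    (hiso : IsIso ι) : ELNatConclusionO k n H ι :=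
  elnatO_of_isRegular p hp k n H ι hι hH (Scheme.IsRegular.of_iso (inv ι) (isRegular_projectiveSpace n k))

/-- **EL♮(n) at `p` reduces exactly to its hypersurface instances.**  If, for the given `p, k, n`, the conclusion `ELNatConclusionO` is known for
every INTEGRAL `H` embedded as the zero locus `range ι = V₊(F)` of a NON-ZERO form `F` of ANY degree `d` (the cut of ✓ `elnat_largeChar`, degree by
degree), then it holds for every `(H, ι)` satisfying the crux hypotheses (`ι` closed immersion, `H` integral, `ker ι` locally principal): by the
dictionary, either `ι` is an isomorphism (`elnat_of_isIso`) or `range ι = V₊(F)` with `F` a prime form. [OURS · DEF-FREE · pure reduction] -/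
theorem elnat_of_hyp_of_forall_degree (p : ℕ) (hp : p.Prime) (k : Type) [Field k] [CharP k p] [IsAlgClosed k] (n : ℕ)
    (hdeg : ∀ (d : ℕ) (H : Scheme.{0}) (ι : H ⟶ (Literature.AlgebraicGeometry.Motives.projectiveSpace n k).left)
      (F : MvPolynomial (Fin (n + 1)) k), F.IsHomogeneous d →
      (IsIntegral H ∧ F ≠ 0 ∧
        letI := MvPolynomial.gradedAlgebra (σ := Fin (n + 1)) (R := k)
        Set.range ι = {x : Proj (homogeneousSubmodule (Fin (n + 1)) k) | F ∈ x.asHomogeneousIdeal}) →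
      ELNatConclusionO k n H ι)
    (H : Scheme.{0}) (ι : H ⟶ (Literature.AlgebraicGeometry.Motives.projectiveSpace n k).left)
    (hι : IsClosedImmersion ι) (hH : IsIntegral H)
    (hpr : ∀ y : (Literature.AlgebraicGeometry.Motives.projectiveSpace n k).left,
      ∃ U : (Literature.AlgebraicGeometry.Motives.projectiveSpace n k).left.affineOpens,
        y ∈ (U : (Literature.AlgebraicGeometry.Motives.projectiveSpace n k).left.Opens) ∧ (ι.ker.ideal U).IsPrincipal) :
    ELNatConclusionO k n H ι := by
  haveI := hι
  haveI := hH
  rcases isIso_or_exists_prime_form_range_eq_of_hyp ι hpr with hiso | ⟨e, F, -, hF, hprime, -, hrange⟩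
  · exact elnat_of_isIso p hp k n H ι hι hH hiso
  · exact hdeg e H ι F hF ⟨hH, hprime.ne_zero, hrange⟩

/-- ★ **RUNG LC in the crux's currency, isomorphism case included.**  For all `n, D` there is `M = M(n, D)` such that for every prime `p > M`,
every algebraically closed `k` of characteristic `p` and every `(H, ι)` satisfying the crux hypotheses, IF `ι` is an isomorphism OR `range ι`
lies on some hypersurface of degree `≤ D` (a non-zero form `G` of degree `e ≤ D` vanishing on it), THEN `ELNatConclusionO k n H ι`
(✓ `elnat_of_isIso`, ✓ `elnat_largeChar_of_hyp`).  A RUNG: `M` ineffective and degree-dependent; NOT EL♮(3) / EL♮; closes no registered stub.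
[OURS · DEF-FREE · ZERO named hypotheses] -/
theorem elnat_largeChar_of_hyp' (n D : ℕ) :
    ∃ M : ℕ, ∀ (p : ℕ), p.Prime → ∀ (k : Type) [Field k] [CharP k p] [IsAlgClosed k], M < p →
      ∀ (H : Scheme.{0}) (ι : H ⟶ (Literature.AlgebraicGeometry.Motives.projectiveSpace n k).left),
        IsClosedImmersion ι → IsIntegral H →
        (∀ y : (Literature.AlgebraicGeometry.Motives.projectiveSpace n k).left,
          ∃ U : (Literature.AlgebraicGeometry.Motives.projectiveSpace n k).left.affineOpens,
            y ∈ (U : (Literature.AlgebraicGeometry.Motives.projectiveSpace n k).left.Opens) ∧ (ι.ker.ideal U).IsPrincipal) →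
        (IsIso ι ∨ ∃ (e : ℕ) (G : MvPolynomial (Fin (n + 1)) k), e ≤ D ∧ G.IsHomogeneous e ∧ G ≠ 0 ∧
          letI := MvPolynomial.gradedAlgebra (σ := Fin (n + 1)) (R := k)
          Set.range ι ⊆ {x : Proj (homogeneousSubmodule (Fin (n + 1)) k) | G ∈ x.asHomogeneousIdeal}) →
        ELNatConclusionO k n H ι := by
  obtain ⟨M, hM⟩ := elnat_largeChar_of_hyp n D
  refine ⟨M, fun p hp k _ _ _ hMp H ι hι hH hpr h => ?_⟩
  rcases h with hiso | hdeg
  · exact elnat_of_isIso p hp k n H ι hι hH hiso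
  · exact hM p hp k hMp H ι hι hH hpr hdeg

end LargeChar

end Summit.ResolutionOfSingularities.ResolutionOfSingularities.Cruxes.EquisingularLiftNat.Sections

end
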